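import Summits.BirchSwinnertonDyer.BirchSwinnertonDyer.Theorems.TwoAdicConverseOrdLambdaHalfAtTwoWbarLayerInduction
import Summits.BirchSwinnertonDyer.BirchSwinnertonDyer.Theorems.TwoAdicConverseOrdLambdaHalfAtTwoGreenbergWbarTwist
import HarnessLib

/-!
# Route `TwoAdicConverse` (rung S3), crux `OrdLambdaHalfAtTwo` (item stmt-BirchSwinnertonDyer-19556), line
# `kato-determinant-greenberg-two`, stub `stub_wbarStepAtTwo` ([C]) — brick R2 = sub-lemma (h2) of the cor–Ver road:
# **`ℚ_∞` (the cyclotomic `ℤ₂`-extension of `ℚ`) has no quadratic extension unramified at the odd primes and at `∞`**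

Cell `bsd-2adic`, seat `bsd-2adic-conv-1` GEN 26 (`--supports` stmt-BirchSwinnertonDyer-19556, helper; pen RC-325).  FUNCTION FORM
(`ker_vanishing`): for `G = Gal(ℚ̄/ℚ_∞) = ker κ_cyc` and an abelian group `M` of order `2`, a function `g : Γ_ℚ → M` that is additive
on `G`, vanishes on `U ∩ G` for some open subgroup `U ≤ Γ_ℚ` (continuity), on every inertia group above every odd prime and on every
complex conjugation, vanishes on `G`.  Proof: `g|_G` is a continuous `1`-cocycle with trivial coefficients; by the tree's descent
(`TwoAdicGreenbergCotorsion.exists_layer_resOfLe_eq_of_trivial`, Greenberg's Lemma 3.2 plumbing, conv-1 GEN 25) it is the restriction of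
a cocycle of some layer `Γ_n = Gal(ℚ̄/ℚ_n)`, i.e. of a quadratic character of `ℚ_n` with the same local behaviour (inertia groups and
complex conjugations lie in `G`); brick R1 (`layer_vanishing`) kills it on `Γ_{n+1} ⊇ G`.

HONEST FRAMING: theorems only (no definition, no named fact, no `sorry`; the trivial `Γ_ℚ`-action on `M` is a proof-local instance);
Galois bookkeeping over `ℚ`; BSD is not proved by any of this.  PARTITION (D-0054): none — RANK axis S3 × X5@2 stratum (β);
types-the-object-of (stub 3b-C).  References: [cite: Washington1997, §13.1, Prop. 13.2]; [cite: GreenbergLNM1716, §3 Lemma 3.2].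
-/

set_option autoImplicit false
-- the route's Theorems namespace repeats the summit name by design (D-0017 nested layout)
set_option linter.dupNamespace false

noncomputable section

open scoped Classical NumberField Pointwise

namespace Summit.BirchSwinnertonDyer.BirchSwinnertonDyer.Theorems.TwoAdicWbarStep

open Function NumberField IsDedekindDomain Field
  Literature.NumberTheory.GaloisRepresentations Literature.NumberTheory.EllipticCurves
  Literature.NumberTheory.EllipticCurves.CocycleCriteria
  Summit.BirchSwinnertonDyer.BirchSwinnertonDyer.Theorems.TwoAdicGreenbergCotorsion

/-- **Sub-lemma (h2) of the cor–Ver road, at the top of the tower.**  `G = ker κ_cyc = Gal(ℚ̄/ℚ_∞)`, `M` of order `2`,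
`g : Γ_ℚ → M` additive on `G`, vanishing on `U ∩ G` for an open subgroup `U`, on the inertia group of every prime of `\bar ℤ` above
every odd prime and on every complex conjugation.  Then `g` vanishes on `G`: `ℚ_∞` has no quadratic extension unramified at the odd
primes in which the real places split. [cite: Washington1997, §13.1] [cite: GreenbergLNM1716, §3 Lemma 3.2] -/
theorem ker_vanishing (M : Type) [AddCommGroup M] [TopologicalSpace M] [DiscreteTopology M] (hM : Nat.card M = 2)
    (g : absoluteGaloisGroup ℚ → M)
    (hadd : ∀ x ∈ (CyclotomicZp.zpExtension 2).kerSubgroup, ∀ y ∈ (CyclotomicZp.zpExtension 2).kerSubgroup,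
      g (x * y) = g x + g y)
    (hU : ∃ U : Subgroup (absoluteGaloisGroup ℚ), IsOpen (U : Set (absoluteGaloisGroup ℚ)) ∧
      ∀ x ∈ U, x ∈ (CyclotomicZp.zpExtension 2).kerSubgroup → g x = 0)
    (hI : ∀ v : HeightOneSpectrum (𝓞 ℚ), ((2 : ℕ) : 𝓞 ℚ) ∉ v.asIdeal →
      ∀ 𝔓 ∈ v.primesAbove, ∀ x ∈ 𝔓.inertia (absoluteGaloisGroup ℚ), g x = 0)
    (hcc : ∀ c₀ : absoluteGaloisGroup ℚ, IsComplexConjugation (Rat.castHom ℝ) c₀ → g c₀ = 0) :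
    ∀ x ∈ (CyclotomicZp.zpExtension 2).kerSubgroup, g x = 0 := by
  set κ := CyclotomicZp.zpExtension 2 with hκdef
  have hκ : κ.IsCyclotomic := CyclotomicZp.isCyclotomic_zpExtension 2
  set G := κ.kerSubgroup with hGdef
  -- the trivial `Γ_ℚ`-action on `M` (proof-local)
  letI inst : DistribMulAction (absoluteGaloisGroup ℚ) M :=
    { smul := fun _ m ↦ m
      one_smul := fun _ ↦ rfl
      mul_smul := fun _ _ _ ↦ rfl
      smul_zero := fun _ ↦ rfl
      smul_add := fun _ _ _ ↦ rfl }
  have htriv : ∀ (σ : absoluteGaloisGroup ℚ) (m : M), σ • m = m := fun _ _ ↦ rfl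
  haveI : Finite M := Nat.finite_of_card_ne_zero (by rw [hM]; norm_num)
  have hg1 : g 1 = 0 := by
    have h := hadd 1 (one_mem _) 1 (one_mem _)
    rw [mul_one] at h
    exact left_eq_add.mp h
  -- `g|_G` is continuous (locally constant: constant on the cosets of `U ∩ G`)
  obtain ⟨U, hUo, hUg⟩ := hU
  have hcont : Continuous fun x : G ↦ g (x : absoluteGaloisGroup ℚ) := by
    refine (IsLocallyConstant.iff_exists_open _).mpr (fun x₀ ↦ ?_) |>.continuous
    refine ⟨{x : G | (x₀ : absoluteGaloisGroup ℚ)⁻¹ * x ∈ U}, ?_, ?_, ?_⟩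
    · exact hUo.preimage ((continuous_const.mul continuous_subtype_val))
    · change (x₀ : absoluteGaloisGroup ℚ)⁻¹ * x₀ ∈ U
      rw [inv_mul_cancel]; exact one_mem U
    · intro x hx
      change (x₀ : absoluteGaloisGroup ℚ)⁻¹ * x ∈ U at hx
      have hxG : (x₀ : absoluteGaloisGroup ℚ)⁻¹ * x ∈ G := mul_mem (inv_mem x₀.2) x.2
      have e : (x : absoluteGaloisGroup ℚ) = x₀ * ((x₀ : absoluteGaloisGroup ℚ)⁻¹ * x) := by group
      change g x = g x₀
      rw [e, hadd _ x₀.2 _ hxG, hUg _ hx hxG, add_zero]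
  -- the cocycle `z` of `g|_G`
  let z : contOneCocycles (discreteTopRep G M) :=
    ⟨⟨fun x ↦ g (x : absoluteGaloisGroup ℚ), hcont⟩, fun a b ↦ by
      change g ((a * b : G) : absoluteGaloisGroup ℚ) = g a + ((a : absoluteGaloisGroup ℚ) • g b : M)
      rw [htriv, Subgroup.coe_mul]
      exact hadd _ a.2 _ b.2⟩
  have hz : ∀ x : G, z.1 x = g x := fun _ ↦ rfl
  -- descent to a layer `Γ_n`
  obtain ⟨γ, hγ⟩ := κ.surjective (Multiplicative.ofAdd 1)
  have hγ' : κ.IsTopGenerator γ := hγ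
  obtain ⟨n, c', hc'⟩ := exists_layer_resOfLe_eq_of_trivial κ M hγ' ⟨1, by rw [pow_one]; exact hM⟩ htriv
    (oneCocycleClass _ z)
  obtain ⟨z', rfl⟩ := oneCocycleClass_surjective _ c'
  have hle : G ≤ κ.layerSubgroup n := κ.kerSubgroup_le_layerSubgroup n
  -- `z'` restricts to `g` on `G` (trivial action: equal classes ⇒ equal cocycles)
  have hzz' : ∀ x : G, z'.1 ⟨x, hle x.2⟩ = g x := by
    rw [resOfLe, resH1Hom_id_oneCocycleClass_eq, ← sub_eq_zero, ← oneCocycleClass_sub, oneCocycleClass_eq_zero_iff] at hc'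
    obtain ⟨m, hm⟩ := hc'
    intro x
    have h := hm x
    change z'.1 ⟨x, hle x.2⟩ - g x = ((x : absoluteGaloisGroup ℚ) • m : M) - m at h
    rw [htriv, sub_self, sub_eq_zero] at h
    exact h
  -- the layer character `χ`
  set χ : absoluteGaloisGroup ℚ → M := fun x ↦ if hx : x ∈ κ.layerSubgroup n then z'.1 ⟨x, hx⟩ else 0 with hχdef
  have hχ : ∀ (x) (hx : x ∈ κ.layerSubgroup n), χ x = z'.1 ⟨x, hx⟩ := fun x hx ↦ by rw [hχdef]; exact dif_pos hx
  have hχG : ∀ x ∈ G, χ x = g x := fun x hx ↦ by rw [hχ x (hle hx)]; exact hzz' ⟨x, hx⟩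
  have hχadd : ∀ x ∈ κ.layerSubgroup n, ∀ y ∈ κ.layerSubgroup n, χ (x * y) = χ x + χ y := by
    intro x hx y hy
    rw [hχ x hx, hχ y hy, hχ (x * y) (mul_mem hx hy)]
    exact cocycle_mul_of_trivial htriv z' ⟨x, hx⟩ ⟨y, hy⟩
  -- its open kernel `V = {x ∈ Γ_n | z' x = 0}`
  have hz'1 : z'.1 1 = 0 := cocycle_one_of_trivial htriv z'
  have hz'inv : ∀ x : κ.layerSubgroup n, z'.1 x⁻¹ = -z'.1 x := fun x ↦ by
    have h := cocycle_mul_of_trivial htriv z' x x⁻¹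
    rw [mul_inv_cancel, hz'1] at h
    exact (neg_eq_of_add_eq_zero_right h.symm).symm
  let V : Subgroup (absoluteGaloisGroup ℚ) :=
    { carrier := {x | ∃ hx : x ∈ κ.layerSubgroup n, z'.1 ⟨x, hx⟩ = 0}
      mul_mem' := by
        rintro x y ⟨hx, hx0⟩ ⟨hy, hy0⟩
        refine ⟨mul_mem hx hy, ?_⟩
        have h := cocycle_mul_of_trivial htriv z' ⟨x, hx⟩ ⟨y, hy⟩
        rw [hx0, hy0, add_zero] at h
        exact h
      one_mem' := ⟨one_mem _, hz'1⟩
      inv_mem' := by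
        rintro x ⟨hx, hx0⟩
        refine ⟨inv_mem hx, ?_⟩
        have h := hz'inv ⟨x, hx⟩
        rw [hx0, neg_zero] at h
        exact h }
  have hVmem : ∀ x, x ∈ V ↔ ∃ hx : x ∈ κ.layerSubgroup n, z'.1 ⟨x, hx⟩ = 0 := fun _ ↦ Iff.rfl
  have hVo : IsOpen (V : Set (absoluteGaloisGroup ℚ)) := by
    have e : (V : Set (absoluteGaloisGroup ℚ)) =
        Subtype.val '' ((fun x : κ.layerSubgroup n ↦ z'.1 x) ⁻¹' {0}) := by
      ext x
      simp only [SetLike.mem_coe, hVmem, Set.mem_image, Set.mem_preimage, Set.mem_singleton_iff, Subtype.exists,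
        exists_and_right, exists_eq_right]
    rw [e]
    exact (ZpExtension.isOpen_layerSubgroup κ n).isOpenMap_subtype_val _
      ((isOpen_discrete {(0 : M)}).preimage z'.1.continuous)
  -- apply brick R1
  have hvan := layer_vanishing hM n χ hχadd
    ⟨V, hVo, fun x hx ↦ ((hVmem x).mp hx).1, fun x hx ↦ by
      obtain ⟨hx', hx0⟩ := (hVmem x).mp hx
      rw [hχ x hx']; exact hx0⟩
    (fun v hv 𝔓 h𝔓 x hx ↦ by
      rw [hχG x (ZpExtension.inertia_le_kerSubgroup_of_isCyclotomic κ hκ hv h𝔓 hx)]; exact hI v hv 𝔓 h𝔓 x hx)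
    (fun c₀ hc₀ ↦ by rw [hχG c₀ (mem_kerSubgroup_of_isComplexConjugation κ hc₀)]; exact hcc c₀ hc₀)
  intro x hx
  rw [← hχG x hx]
  exact hvan x (κ.kerSubgroup_le_layerSubgroup (n + 1) hx)

end Summit.BirchSwinnertonDyer.BirchSwinnertonDyer.Theorems.TwoAdicWbarStep

end
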